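import Literature.Geometry.Lorentzian.Basic
import Literature.Analysis.Calculus.SmoothCutoff
import Literature.Analysis.Calculus.HardyExteriorDecay
import Mathlib.MeasureTheory.Measure.Haar.InnerProductSpace

/-!
# Route ClusterCompleteness — crux `AdiabaticMultiKerrILED`, line `Sketch`: perforated Hardy
# inequality, part 1: cubical plateaus, coordinate boxes, the whole-space inequality

Helper file for the crux `stmt-FinalStateConjecture-14310`
(`Summit.FinalStateConjecture.FinalStateConjecture.Theses.ClusterCompleteness.AdiabaticMultiKerrILED`),
stub `stub_perforatedHardy` (the Hardy inequality `∫ φ²/‖y − y₀‖² ≲ ∫ |∇φ|²` on `ℝ³` minus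
finitely many separated balls). The proof of that stub extends `φ` across the holes by
`u = φ + Σᵢ Pᵢ (mᵢ − φ)` with *cubical* plateau functions `Pᵢ` (`= 1` on a cube containing the
`i`-th hole, `= 0` off a slightly larger cube) and constants `mᵢ` (local means of `φ`), and
controls `∫ |∇u|²` by Poincaré inequalities on cubes. This file provides the elementary
ingredients:

* `exists_cube_plateau` — for one universal `D`: given a centre `z`, a scale `ρ > 0` and
  `a < b`, a `C¹` function `χ : E3 → [0, 1]`, `= 1` near the open cube `‖y − z‖_∞ < aρ`, `= 0`
  near the complement of the closed cube `‖y − z‖_∞ ≤ bρ`, with `‖Dχ‖ ≤ 3D/((b − a)ρ)` (the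
  product of three plateaus `cutoff (b/(b−a)) ((y_k − z_k)/((b − a)ρ))` of
  `Literature.Analysis.Calculus.SmoothCutoff`);
* coordinate boxes `{y | ∀ k, y_k ∈ (p_k, q_k)}` of `E3 = ℝ³`: openness, volume `∏ (q_k − p_k)`,
  compactness of the closed box, and `‖y‖² = Σ y_k²`;
* `hardy_whole_space_of_decay`: for `u ∈ C¹(ℝ³)` with `∫_{‖y‖>R} u²/‖y‖² < ∞` for some `R`,
  `∫ u²/‖y − y₀‖² ≤ 4 ∫ ‖Du‖²` for every centre `y₀` (`ℝ≥0∞`-valued integrals): the exterior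
  inequality with decay of `Literature.Analysis.Calculus.HardyExteriorDecay` about the centre
  `y₀`, exhausted over the exteriors `{‖y − y₀‖ > 1/(k+1)}`.

Folklore calculus. [folklore]
-/

noncomputable section

-- the doubled `FinalStateConjecture.FinalStateConjecture` path component trips dupNamespace
set_option linter.dupNamespace false

open Literature.Geometry.Lorentzian Literature.Analysis.Calculus MeasureTheory Set Filter Metric
open scoped Topology ENNReal

namespace Summit.FinalStateConjecture.FinalStateConjecture.Cruxes.AdiabaticMultiKerrILED.Sketch

/-! ### Coordinates of `E3` -/

/-- `‖y‖² = Σ_k y_k²` in `E3`. [folklore] -/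
theorem norm_sq_eq_sum (y : E3) : ‖y‖ ^ 2 = ∑ k, (y k) ^ 2 := by
  rw [EuclideanSpace.norm_eq, Real.sq_sqrt (by positivity)]
  simp

/-! ### The cubical plateau -/

/-- **Cubical plateau functions.** There is a universal constant `D ≥ 0` such that for every
centre `z`, scale `ρ > 0` and `a < b` there is a `C¹` function `χ : E3 → [0, 1]` which is
(eventually) `1` near every point of the open cube `|y_k − z_k| < aρ`, (eventually) `0` near every
point outside the closed cube `|y_k − z_k| ≤ bρ`, and has `‖Dχ‖ ≤ 3D/((b − a)ρ)` everywhere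
(`χ(y) = ∏_k cutoff (b/(b−a)) ((y_k − z_k)/((b−a)ρ))`). [folklore] -/
theorem exists_cube_plateau :
    ∃ D : ℝ, 0 ≤ D ∧ ∀ (z : Fin 3 → ℝ) (ρ a b : ℝ), 0 < ρ → a < b →
      ∃ χ : E3 → ℝ, ContDiff ℝ 1 χ ∧ (∀ y, 0 ≤ χ y ∧ χ y ≤ 1) ∧
        (∀ y : E3, (∀ k, |y k - z k| < a * ρ) → χ =ᶠ[𝓝 y] fun _ => 1) ∧
        (∀ y : E3, (∃ k, b * ρ < |y k - z k|) → χ =ᶠ[𝓝 y] fun _ => 0) ∧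
        ∀ y, ‖fderiv ℝ χ y‖ ≤ 3 * (D / ((b - a) * ρ)) := by
  obtain ⟨D, hD0, hD⟩ := exists_bound_deriv_cutoff
  refine ⟨D, hD0, fun z ρ a b hρ hab => ?_⟩
  have hba : 0 < b - a := sub_pos.mpr hab
  -- the one-dimensional plateau `pl t = cutoff (b/(b−a)) (t/(b−a))`
  set R : ℝ := b / (b - a) with hR
  set pl : ℝ → ℝ := fun t => cutoff R (t / (b - a)) with hpl
  have hpl1 : ∀ t, |t| ≤ a → pl t = 1 := fun t ht => by
    refine cutoff_eq_one ?_
    rw [abs_div, abs_of_pos hba, div_le_iff₀ hba]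
    have : (R - 1) * (b - a) = a := by rw [hR]; field_simp; ring
    rw [this]; exact ht
  have hpl0 : ∀ t, b ≤ |t| → pl t = 0 := fun t ht => by
    refine cutoff_eq_zero ?_
    rw [abs_div, abs_of_pos hba, le_div_iff₀ hba]
    have : R * (b - a) = b := by rw [hR]; field_simp
    rw [this]; exact ht
  have hplC : ContDiff ℝ 1 pl := (contDiff_cutoff R).comp (contDiff_id.div_const _)
  have hplD : ∀ t, HasDerivAt pl (deriv (cutoff R) (t / (b - a)) / (b - a)) t := fun t => by
    have h1 : HasDerivAt (cutoff R) (deriv (cutoff R) (t / (b - a))) (t / (b - a)) :=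
      (hasDerivAt_cutoff _ _).differentiableAt.hasDerivAt
    have h2 : HasDerivAt (fun t : ℝ => t / (b - a)) (1 / (b - a)) t := by
      simpa using (hasDerivAt_id t).div_const (b - a)
    have h := h1.comp t h2
    have e : deriv (cutoff R) (t / (b - a)) * (1 / (b - a)) =
        deriv (cutoff R) (t / (b - a)) / (b - a) := by ring
    rw [e] at h
    exact h
  have hpl01 : ∀ t, 0 ≤ pl t ∧ pl t ≤ 1 := fun t => ⟨cutoff_nonneg _ _, cutoff_le_one _ _⟩
  -- coordinates
  have hcoord : ∀ (k : Fin 3) (y : E3), |y k| ≤ ‖y‖ := fun k y => by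
    have := PiLp.norm_apply_le y k
    simpa using this
  have hproj : ∀ k : Fin 3, ‖(EuclideanSpace.proj (𝕜 := ℝ) k : E3 →L[ℝ] ℝ)‖ ≤ 1 := fun k => by
    refine ContinuousLinearMap.opNorm_le_bound _ zero_le_one fun y => ?_
    rw [one_mul]
    exact hcoord k y
  -- the coordinate factors `g k y = pl ((y_k − z_k)/ρ)`
  set g : Fin 3 → E3 → ℝ := fun k y => pl ((y k - z k) / ρ) with hg
  have hgC : ∀ k, ContDiff ℝ 1 (g k) := fun k => by
    have hk : ContDiff ℝ 1 fun y : E3 => y k := (EuclideanSpace.proj (𝕜 := ℝ) k).contDiff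
    exact hplC.comp ((hk.sub contDiff_const).div_const _)
  have hg01 : ∀ k y, 0 ≤ g k y ∧ g k y ≤ 1 := fun k y => hpl01 _
  have hgabs : ∀ k y, |g k y| ≤ 1 := fun k y => by
    rw [abs_of_nonneg (hg01 k y).1]; exact (hg01 k y).2
  have hgD : ∀ k y, ‖fderiv ℝ (g k) y‖ ≤ D / ((b - a) * ρ) := fun k y => by
    have hin : HasFDerivAt (fun y : E3 => (y k - z k) / ρ)
        (ρ⁻¹ • (EuclideanSpace.proj (𝕜 := ℝ) k : E3 →L[ℝ] ℝ)) y := by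
      have h1 := (((EuclideanSpace.proj (𝕜 := ℝ) k).hasFDerivAt (x := y)).sub_const
        (z k)).const_mul ρ⁻¹
      exact h1.congr_of_eventuallyEq (Eventually.of_forall fun w => by
        simp [div_eq_inv_mul])
    have hcomp := (hplD ((y k - z k) / ρ)).comp_hasFDerivAt y hin
    have heq : (pl ∘ fun y : E3 => (y k - z k) / ρ) = g k := rfl
    rw [heq] at hcomp
    rw [hcomp.fderiv]
    set d : ℝ := deriv (cutoff R) ((y k - z k) / ρ / (b - a)) / (b - a) with hd
    have hdle : |d| ≤ D / (b - a) := by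
      rw [hd, abs_div, abs_of_pos hba]
      exact div_le_div_of_nonneg_right (hD _ _) hba.le
    calc ‖d • (ρ⁻¹ • (EuclideanSpace.proj (𝕜 := ℝ) k : E3 →L[ℝ] ℝ))‖
        = |d| * (ρ⁻¹ * ‖(EuclideanSpace.proj (𝕜 := ℝ) k : E3 →L[ℝ] ℝ)‖) := by
          rw [norm_smul, norm_smul, Real.norm_eq_abs, Real.norm_eq_abs, abs_of_pos (inv_pos.2 hρ)]
      _ ≤ D / (b - a) * (ρ⁻¹ * 1) := by
          refine mul_le_mul hdle ?_ (by positivity) (by positivity)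
          exact mul_le_mul_of_nonneg_left (hproj k) (inv_pos.2 hρ).le
      _ = D / ((b - a) * ρ) := by field_simp
  -- product rule bound for `[−1, 1]`-valued factors
  have hmul : ∀ {f f' : E3 → ℝ} {y : E3}, DifferentiableAt ℝ f y → DifferentiableAt ℝ f' y →
      |f y| ≤ 1 → |f' y| ≤ 1 →
      ‖fderiv ℝ (fun w => f w * f' w) y‖ ≤ ‖fderiv ℝ f y‖ + ‖fderiv ℝ f' y‖ := by
    intro f f' y hf hf' h1 h1'
    rw [fderiv_fun_mul hf hf']
    calc ‖f y • fderiv ℝ f' y + f' y • fderiv ℝ f y‖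
        ≤ ‖f y • fderiv ℝ f' y‖ + ‖f' y • fderiv ℝ f y‖ := norm_add_le _ _
      _ ≤ ‖fderiv ℝ f' y‖ + ‖fderiv ℝ f y‖ := by
          rw [norm_smul, norm_smul, Real.norm_eq_abs, Real.norm_eq_abs]
          exact add_le_add (mul_le_of_le_one_left (norm_nonneg _) h1)
            (mul_le_of_le_one_left (norm_nonneg _) h1')
      _ = _ := add_comm _ _
  -- the cubical plateau
  set χ : E3 → ℝ := fun y => g 0 y * g 1 y * g 2 y with hχ
  have hχprod : ∀ y, χ y = ∏ k, g k y := fun y => by rw [Fin.prod_univ_three]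
  have hd : ∀ k y, DifferentiableAt ℝ (g k) y := fun k y => ((hgC k).differentiable (by simp)) y
  refine ⟨χ, ((hgC 0).mul (hgC 1)).mul (hgC 2), fun y => ?_, fun y hy => ?_, fun y hy => ?_,
    fun y => ?_⟩
  · exact ⟨mul_nonneg (mul_nonneg (hg01 0 y).1 (hg01 1 y).1) (hg01 2 y).1,
      mul_le_one₀ (mul_le_one₀ (hg01 0 y).2 (hg01 1 y).1 (hg01 1 y).2) (hg01 2 y).1 (hg01 2 y).2⟩
  · -- eventually `1` on the open inner cube
    have ho : IsOpen {y : E3 | ∀ k, |y k - z k| < a * ρ} := by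
      simp only [setOf_forall]
      exact isOpen_iInter_of_finite fun k => isOpen_lt (by fun_prop) continuous_const
    filter_upwards [ho.mem_nhds hy] with w hw
    have h1 : ∀ k, g k w = 1 := fun k => hpl1 _ (by
      rw [abs_div, abs_of_pos hρ, div_le_iff₀ hρ]; exact (hw k).le)
    simp [hχ, h1]
  · -- eventually `0` off the closed outer cube
    obtain ⟨k, hk⟩ := hy
    have ho : IsOpen {y : E3 | b * ρ < |y k - z k|} := isOpen_lt continuous_const (by fun_prop)
    filter_upwards [ho.mem_nhds hk] with w hw
    have h0 : g k w = 0 := hpl0 _ (by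
      rw [abs_div, abs_of_pos hρ, le_div_iff₀ hρ]; exact le_of_lt hw)
    rw [hχprod]
    exact Finset.prod_eq_zero (Finset.mem_univ k) h0
  · -- the gradient bound
    have h01 : ‖fderiv ℝ (fun w => g 0 w * g 1 w) y‖ ≤ 2 * (D / ((b - a) * ρ)) := by
      calc _ ≤ ‖fderiv ℝ (g 0) y‖ + ‖fderiv ℝ (g 1) y‖ :=
            hmul (hd 0 y) (hd 1 y) (hgabs 0 y) (hgabs 1 y)
        _ ≤ D / ((b - a) * ρ) + D / ((b - a) * ρ) := add_le_add (hgD 0 y) (hgD 1 y)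
        _ = _ := by ring
    have hp : |g 0 y * g 1 y| ≤ 1 := by
      rw [abs_mul]; exact mul_le_one₀ (hgabs 0 y) (abs_nonneg _) (hgabs 1 y)
    have h := hmul ((hd 0 y).mul (hd 1 y)) (hd 2 y) hp (hgabs 2 y)
    calc ‖fderiv ℝ χ y‖ = ‖fderiv ℝ (fun w => (g 0 w * g 1 w) * g 2 w) y‖ := rfl
      _ ≤ 2 * (D / ((b - a) * ρ)) + D / ((b - a) * ρ) := h.trans (add_le_add h01 (hgD 2 y))
      _ = 3 * (D / ((b - a) * ρ)) := by ring

/-! ### Coordinate boxes -/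

/-- The open coordinate box `{y | ∀ k, p_k < y_k < q_k}` of `E3` is open. [folklore] -/
theorem isOpen_coordBox (p q : Fin 3 → ℝ) : IsOpen {y : E3 | ∀ k, y k ∈ Ioo (p k) (q k)} := by
  simp only [setOf_forall]
  exact isOpen_iInter_of_finite fun k => isOpen_Ioo.preimage (by fun_prop)

/-- **Volume of a coordinate box**: `vol {y | ∀ k, p_k < y_k < q_k} = ∏ (q_k − p_k)`
(for `p ≤ q`; Lebesgue measure of `E3` is the product measure). [folklore] -/
theorem volume_coordBox (p q : Fin 3 → ℝ) :
    volume {y : E3 | ∀ k, y k ∈ Ioo (p k) (q k)} = ∏ k, ENNReal.ofReal (q k - p k) := by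
  have h : {y : E3 | ∀ k, y k ∈ Ioo (p k) (q k)} =
      (WithLp.ofLp : E3 → Fin 3 → ℝ) ⁻¹' Set.pi univ fun k => Ioo (p k) (q k) := by
    ext y; simp
  rw [h, (PiLp.volume_preserving_ofLp (Fin 3)).measure_preimage
    (MeasurableSet.univ_pi fun k => measurableSet_Ioo).nullMeasurableSet, Real.volume_pi_Ioo]

/-- The closed coordinate box `{y | ∀ k, p_k ≤ y_k ≤ q_k}` of `E3` is compact. [folklore] -/
theorem isCompact_coordBox (p q : Fin 3 → ℝ) :
    IsCompact {y : E3 | ∀ k, y k ∈ Icc (p k) (q k)} := by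
  have h : {y : E3 | ∀ k, y k ∈ Icc (p k) (q k)} =
      (WithLp.toLp 2 : (Fin 3 → ℝ) → E3) '' Set.pi univ fun k => Icc (p k) (q k) := by
    ext y
    simp only [mem_setOf_eq, mem_image, mem_univ_pi]
    constructor
    · intro hy; exact ⟨WithLp.ofLp y, hy, rfl⟩
    · rintro ⟨f, hf, rfl⟩; simpa using hf
  rw [h]
  exact (isCompact_univ_pi fun k => isCompact_Icc).image (PiLp.continuous_toLp 2 _)

/-! ### Whole-space Hardy inequality with decay -/

/-- **Whole-space Hardy inequality under a decay hypothesis** (`ℝ³`, constant `4`): if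
`u : E3 → ℝ` is `C¹` and `∫_{‖y‖ > R} u²/‖y‖² < ∞` for some `R`, then for every `y₀`,
`∫ u²/‖y − y₀‖² ≤ 4 ∫ ‖Du‖²`. [folklore] -/
theorem hardy_whole_space_of_decay :
    ∀ (u : E3 → ℝ), (∀ y, ContDiffAt ℝ 1 u y) →
      (∃ R : ℝ, ∫⁻ y in {y : E3 | R < ‖y‖}, ENNReal.ofReal (u y ^ 2 / ‖y‖ ^ 2) < ⊤) →
      ∀ y₀ : E3, ∫⁻ y, ENNReal.ofReal (u y ^ 2 / ‖y - y₀‖ ^ 2) ≤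
        4 * ∫⁻ y, ENNReal.ofReal (‖fderiv ℝ u y‖ ^ 2) := by
  intro u hu hdec y₀
  obtain ⟨R, hR⟩ := hdec
  have finrank_E3 : Module.finrank ℝ E3 = 3 := by simp
  -- translated set integrals over exteriors
  have htr_ext : ∀ (F : E3 → ℝ≥0∞) (R : ℝ),
      ∫⁻ y in {y : E3 | R < ‖y + y₀‖}, F (y + y₀) = ∫⁻ z in {z : E3 | R < ‖z‖}, F z := by
    intro F R
    have hmp : MeasurePreserving (fun y : E3 => y + y₀) volume volume :=
      measurePreserving_add_right volume y₀
    have hme : MeasurableEmbedding (fun y : E3 => y + y₀) :=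
      (MeasurableEquiv.addRight y₀).measurableEmbedding
    exact hmp.setLIntegral_comp_preimage_emb hme F {z : E3 | R < ‖z‖}
  have huc : Continuous u := (contDiff_iff_contDiffAt.2 hu).continuous
  -- the translate `v = u(· + y₀)`
  set v : E3 → ℝ := fun y => u (y + y₀) with hv
  have hvC : ∀ y, ContDiffAt ℝ 1 v y := fun y =>
    (hu (y + y₀)).comp y (contDiffAt_id.add contDiffAt_const)
  have hvc : Continuous v := huc.comp (continuous_id.add continuous_const)
  have hDv : ∀ y, fderiv ℝ v y = fderiv ℝ u (y + y₀) := fun y => fderiv_comp_add_right y₀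
  set F : E3 → ℝ≥0∞ := fun z => ENNReal.ofReal (u z ^ 2 / ‖z‖ ^ 2) with hF
  -- finiteness of `∫_{r < ‖y‖} v²/‖y‖²` for every `r > 0`
  have hfin : ∀ r : ℝ, 0 < r →
      ∫⁻ y in {y : E3 | r < ‖y‖}, ENNReal.ofReal (v y ^ 2 / ‖y‖ ^ 2) < ⊤ := by
    intro r hr
    set R' : ℝ := |R| + ‖y₀‖ + 1 with hR'
    -- near part: bounded integrand on a set of finite measure
    obtain ⟨C, hC⟩ := (isCompact_closedBall (0 : E3) R').exists_bound_of_continuousOn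
      hvc.continuousOn
    have hnear : ∫⁻ y in {y : E3 | r < ‖y‖} ∩ closedBall 0 R',
        ENNReal.ofReal (v y ^ 2 / ‖y‖ ^ 2) < ⊤ := by
      refine lt_of_le_of_lt (setLIntegral_mono' (μ := volume)
        ((isOpen_lt continuous_const continuous_norm).measurableSet.inter
          measurableSet_closedBall)
        (g := fun _ => ENNReal.ofReal (C ^ 2 / r ^ 2)) fun y hy => ?_) ?_
      · refine ENNReal.ofReal_le_ofReal ?_
        have hyr : r < ‖y‖ := hy.1
        have hvy : |v y| ≤ C := by simpa [Real.norm_eq_abs] using hC y hy.2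
        have h1 : v y ^ 2 ≤ C ^ 2 := by
          rw [← sq_abs (v y)]
          exact pow_le_pow_left₀ (abs_nonneg _) hvy 2
        have h2 : r ^ 2 ≤ ‖y‖ ^ 2 := pow_le_pow_left₀ hr.le hyr.le 2
        calc v y ^ 2 / ‖y‖ ^ 2 ≤ C ^ 2 / ‖y‖ ^ 2 :=
              div_le_div_of_nonneg_right h1 (sq_nonneg _)
          _ ≤ C ^ 2 / r ^ 2 := div_le_div_of_nonneg_left (sq_nonneg _) (by positivity) h2
      · rw [setLIntegral_const]
        exact ENNReal.mul_lt_top ENNReal.ofReal_lt_top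
          ((measure_mono inter_subset_right).trans_lt measure_closedBall_lt_top)
    -- far part: compare with the decay hypothesis about the centre `0`
    have hfar : ∫⁻ y in {y : E3 | R' < ‖y‖}, ENNReal.ofReal (v y ^ 2 / ‖y‖ ^ 2) < ⊤ := by
      have hpt : ∀ y ∈ {y : E3 | R' < ‖y‖},
          ENNReal.ofReal (v y ^ 2 / ‖y‖ ^ 2) ≤ 4 * F (y + y₀) := by
        intro y hy
        have hy' : R' < ‖y‖ := hy
        have hy0 : ‖y₀‖ ≤ ‖y‖ := by
          have : ‖y₀‖ ≤ R' := by rw [hR']; linarith [abs_nonneg R]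
          linarith
        have hypos : 0 < ‖y‖ := by
          have : 0 ≤ |R| + ‖y₀‖ := by positivity
          linarith
        rw [hF, show (4 : ℝ≥0∞) = ENNReal.ofReal 4 by simp, ← ENNReal.ofReal_mul (by norm_num)]
        refine ENNReal.ofReal_le_ofReal ?_
        have hle : ‖y + y₀‖ ≤ 2 * ‖y‖ := (norm_add_le _ _).trans (by linarith)
        rcases eq_or_lt_of_le (norm_nonneg (y + y₀)) with h0 | h0
        · -- `y + y₀ = 0`: then `u (y + y₀)² / ‖y‖²` is bounded by `0`? use the crude bound
          have hsq : ‖y + y₀‖ ^ 2 = 0 := by rw [← h0]; ring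
          have : ‖y‖ ≤ ‖y₀‖ := by
            have h1 : y + y₀ = 0 := norm_eq_zero.1 h0.symm
            have h2 : y = -y₀ := eq_neg_of_add_eq_zero_left h1
            rw [h2, norm_neg]
          have hyy : ‖y‖ = ‖y₀‖ := le_antisymm this hy0
          -- then `‖y‖ = ‖y₀‖ < R'`, contradiction with `R' < ‖y‖`
          exfalso
          have : ‖y₀‖ < R' := by rw [hR']; linarith [abs_nonneg R]
          linarith
        · have h4 : ‖y + y₀‖ ^ 2 ≤ 4 * ‖y‖ ^ 2 := by nlinarith [norm_nonneg (y + y₀)]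
          show u (y + y₀) ^ 2 / ‖y‖ ^ 2 ≤ 4 * (u (y + y₀) ^ 2 / ‖y + y₀‖ ^ 2)
          rw [div_le_iff₀ (by positivity)]
          calc u (y + y₀) ^ 2 = (u (y + y₀) ^ 2 / ‖y + y₀‖ ^ 2) * ‖y + y₀‖ ^ 2 := by
                field_simp
            _ ≤ (u (y + y₀) ^ 2 / ‖y + y₀‖ ^ 2) * (4 * ‖y‖ ^ 2) :=
                mul_le_mul_of_nonneg_left h4 (by positivity)
            _ = 4 * (u (y + y₀) ^ 2 / ‖y + y₀‖ ^ 2) * ‖y‖ ^ 2 := by ring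
      have hsub : {y : E3 | R' < ‖y‖} ⊆ {y : E3 | R < ‖y + y₀‖} := by
        intro y hy
        have hy' : R' < ‖y‖ := hy
        show R < ‖y + y₀‖
        have h1 : ‖y‖ ≤ ‖y + y₀‖ + ‖y₀‖ := by
          calc ‖y‖ = ‖(y + y₀) - y₀‖ := by rw [add_sub_cancel_right]
            _ ≤ ‖y + y₀‖ + ‖y₀‖ := norm_sub_le _ _
        have h2 : R ≤ |R| := le_abs_self R
        rw [hR'] at hy'
        linarith
      calc ∫⁻ y in {y : E3 | R' < ‖y‖}, ENNReal.ofReal (v y ^ 2 / ‖y‖ ^ 2)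
          ≤ ∫⁻ y in {y : E3 | R' < ‖y‖}, 4 * F (y + y₀) :=
            setLIntegral_mono' (isOpen_lt continuous_const continuous_norm).measurableSet hpt
        _ ≤ ∫⁻ y in {y : E3 | R < ‖y + y₀‖}, 4 * F (y + y₀) := lintegral_mono_set hsub
        _ = 4 * ∫⁻ y in {y : E3 | R < ‖y + y₀‖}, F (y + y₀) :=
            lintegral_const_mul' _ _ ENNReal.ofNat_ne_top
        _ = 4 * ∫⁻ z in {z : E3 | R < ‖z‖}, F z := by
            rw [htr_ext F R]
        _ < ⊤ := ENNReal.mul_lt_top ENNReal.ofNat_lt_top hR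
    -- combine
    have hcov : {y : E3 | r < ‖y‖} ⊆ ({y : E3 | r < ‖y‖} ∩ closedBall 0 R') ∪ {y : E3 | R' < ‖y‖} := by
      intro y hy
      by_cases h : ‖y‖ ≤ R'
      · exact Or.inl ⟨hy, mem_closedBall_zero_iff.2 h⟩
      · exact Or.inr (lt_of_not_ge h)
    calc ∫⁻ y in {y : E3 | r < ‖y‖}, ENNReal.ofReal (v y ^ 2 / ‖y‖ ^ 2)
        ≤ ∫⁻ y in ({y : E3 | r < ‖y‖} ∩ closedBall 0 R') ∪ {y : E3 | R' < ‖y‖},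
            ENNReal.ofReal (v y ^ 2 / ‖y‖ ^ 2) := lintegral_mono_set hcov
      _ ≤ _ := lintegral_union_le _ _ _
      _ < ⊤ := ENNReal.add_lt_top.2 ⟨hnear, hfar⟩
  -- Hardy on each exterior `{r < ‖y‖}`, `r > 0`
  have hext : ∀ r : ℝ, 0 < r →
      ∫⁻ y in {y : E3 | r < ‖y‖}, ENNReal.ofReal (v y ^ 2 / ‖y‖ ^ 2) ≤
        4 * ∫⁻ y, ENNReal.ofReal (‖fderiv ℝ u y‖ ^ 2) := by
    intro r hr
    have h := hardy_sq_lintegral_exterior_le_of_integrable (R₀ := 0) hr hr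
      (fun y _ => hvC y) (hfin r hr) finrank_E3.ge
    have hc : ENNReal.ofReal ((2 / ((Module.finrank ℝ E3 : ℝ) - 2)) ^ 2) = 4 := by
      rw [finrank_E3]; norm_num
    rw [hc] at h
    refine h.trans ?_
    gcongr 4 * ?_
    calc ∫⁻ y in {y : E3 | r < ‖y‖}, ENNReal.ofReal (‖fderiv ℝ v y‖ ^ 2)
        ≤ ∫⁻ y, ENNReal.ofReal (‖fderiv ℝ v y‖ ^ 2) := setLIntegral_le_lintegral _ _
      _ = ∫⁻ y, ENNReal.ofReal (‖fderiv ℝ u y‖ ^ 2) := by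
          simp_rw [hDv]
          exact lintegral_add_right_eq_self (μ := (volume : Measure E3))
            (fun y => ENNReal.ofReal (‖fderiv ℝ u y‖ ^ 2)) y₀
  -- exhaustion `r = 1/(k+1) → 0`
  set Φ : E3 → ℝ≥0∞ := fun y => ENNReal.ofReal (v y ^ 2 / ‖y‖ ^ 2) with hΦ
  set S : ℕ → Set E3 := fun k => {y : E3 | ((k : ℝ) + 1)⁻¹ < ‖y‖} with hS
  have hU : (⋃ k, S k) = ({0} : Set E3)ᶜ := by
    ext y
    simp only [mem_iUnion, hS, mem_setOf_eq, mem_compl_iff, mem_singleton_iff]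
    constructor
    · rintro ⟨k, hk⟩ h0
      rw [h0, norm_zero] at hk
      exact lt_irrefl _ (hk.trans (by positivity))
    · intro hy
      obtain ⟨k, hk⟩ := exists_nat_one_div_lt (norm_pos_iff.2 hy)
      exact ⟨k, by rwa [one_div] at hk⟩
  have hdir : Directed (· ⊆ ·) S := by
    refine Monotone.directed_le fun k l hkl y hy => ?_
    have hy' : ((k : ℝ) + 1)⁻¹ < ‖y‖ := hy
    show ((l : ℝ) + 1)⁻¹ < ‖y‖
    have hk1 : (0 : ℝ) < (k : ℝ) + 1 := by positivity
    have : ((l : ℝ) + 1)⁻¹ ≤ ((k : ℝ) + 1)⁻¹ :=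
      inv_anti₀ hk1 (by exact_mod_cast Nat.succ_le_succ hkl)
    exact this.trans_lt hy'
  have hwhole : ∫⁻ y, Φ y ≤ 4 * ∫⁻ y, ENNReal.ofReal (‖fderiv ℝ u y‖ ^ 2) := by
    have h0 : ∫⁻ y in ({0} : Set E3), Φ y = 0 :=
      setLIntegral_measure_zero _ _ (measure_singleton _)
    rw [← lintegral_add_compl Φ (measurableSet_singleton (0 : E3)), h0, zero_add, ← hU,
      setLIntegral_iUnion_of_directed Φ hdir]
    exact iSup_le fun k => hext _ (by positivity)
  -- back to the centre `y₀`
  have htr : ∫⁻ y, ENNReal.ofReal (u y ^ 2 / ‖y - y₀‖ ^ 2) = ∫⁻ y, Φ y := by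
    rw [hΦ]
    have := lintegral_add_right_eq_self (μ := (volume : Measure E3))
      (fun y => ENNReal.ofReal (u y ^ 2 / ‖y - y₀‖ ^ 2)) y₀
    simp only [add_sub_cancel_right] at this
    rw [← this]
  rw [htr]
  exact hwhole

end Summit.FinalStateConjecture.FinalStateConjecture.Cruxes.AdiabaticMultiKerrILED.Sketch

end
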